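import Summits.BirchSwinnertonDyer.BirchSwinnertonDyer.Theorems.SylvesterTwoHeegnerIndexCMNormForm
import Mathlib.Algebra.Ring.Action.Basic
import Mathlib.Algebra.Group.Subgroup.Basic
import Mathlib.FieldTheory.Finite.Basic
import HarnessLib

/-!
# The Kummer exclusion for a cube root over an «abelian-by-(3-prime)» quotient — step (B) of the split prime-conductor
# Chebotarev–Kummer supply (c′)
# (cell `bsd-stepL`, seat `bsd-stepL-corner3-p2` g15 = lane B, LINE OWNER of crux 21420 `CornerAtThreeW`; `--supports stmt-BirchSwinnertonDyer-21420 --as helper`)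

WHY. Conjunct (c′) of the r18/r19 residual stub of `Cruxes/CornerAtThreeW/Lines/inert.lean` (lane B g14 memo CORNER3-G14 §6–§7)
needs a Frobenius that is trivial on `F = K[m₀](μ_{3^E})`, equal to `−I` on `E[3]`, AND non-trivial on a cube root `α` of a
non-cube `x ∈ K`. The last requirement is met by multiplying a witness `γ₀` by an element `n` of
`N = Gal(ℚ̄ / F·K(E[3]))` moving `α` — which exists iff `α ∉ F(E[3])`: the KUMMER EXCLUSION. THIS FILE proves it as pure group
theory (`exists_mem_map_eq_one_smul_ne`): a group `Γ` acts on a field `L` (`char ≠ 3`); `H ≤ Γ` («`Γ_K`») fixes `x`, and no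
`H`-fixed element of `L` is a cube root of `x` («`x ∉ K³`», fixed field `= K`); `P₀ ≤ H` («`Gal(ℚ̄/F)`») is normalised by `H` with
ALL COMMUTATORS of `H` in `P₀` («`F/K` abelian») and fixes a primitive cube root of unity `ω`, which some element of `H` moves
(«`ω ∉ K`»); `ρ : Γ → M` («`ρ̄_{E,3}`») has `ρ(p)` of order prime to `3` for `p ∈ P₀` («`3 ∤ #ρ̄(Γ_ℚ)`»). THEN some `n ∈ P₀` with
`ρ n = 1` moves `α`. Proof: (i) `p ∈ P₀` fixes `ω`, so acts on the cube roots `ω^j α` by a rotation `η_p ∈ μ₃`; `p^k ∈ P₀ ∩ ker ρ`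
with `3 ∤ k` fixes `α` (if the conclusion failed), so `η_p^k = 1`, `η_p = 1`: `P₀` FIXES `α`. (ii) Pick `c ∈ H` with `c ω = ω²`.
If some `h ∈ H` fixes `ω` but moves `α` (`h α = ω^i α`, `i ≠ 0`), the commutator `[h, c] ∈ P₀` fixes all roots, so
`h c α = c h α`, i.e. `ω^{m+i} = ω^{m+2i}`, `ω^i = 1` — absurd. Otherwise every `h ∈ H` fixing `ω` fixes `α`, and then the root
`ω^{2m} α` (`c α = ω^m α`) is fixed by all of `H = H_ω ∪ c H_ω` — an `H`-fixed cube root of `x`, absurd.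
HONEST FRAMING: THEOREMS ONLY (no definition, no named fact, no `sorry`); abstract group/field algebra, no number theory;
nothing about any CM point or any crux object; no stub ∕ item closes; 21420 OPEN; no census label moves (T7); BSD is proved for
no curve.
References (locators only): [cite: Cox2013, §5.B and §8.B (Kummer theory for cube roots, genus/ring class fields)]
[cite: GrossLMS1991, §9 (choice of Frobenius in a coset, Kummer independence)].
presearch: none in tree for this abstract form (`lean search 'smul_ne.*pow_three|cube.*fixed|Kummer.*exclusion'`: er5 -w2's
`AuxPrimeSupply.kummerExclusion_of_norm_eq_pow` is the SURJECTIVE `p ≥ 5` analogue by descent, not reusable at `3` with image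
`N(C)`); `ω³ = 1` reused from `SylvesterTwoCMNormForm.omega_pow_three`. Axioms: `propext`, `Classical.choice`, `Quot.sound`.
-/

set_option autoImplicit false
set_option linter.dupNamespace false

namespace Summit.BirchSwinnertonDyer.BirchSwinnertonDyer.Theorems.ChebKummerThree

/-! ### §1 Cube roots of unity in a field of characteristic `≠ 3` -/

section CubeRoots

variable {L : Type*} [Field L] {ω : L}

-- `ω³ = 1` is the tree's `SylvesterTwoCMNormForm.omega_pow_three` (reused, not restated).

/-- `ω² + ω + 1 = 0`, `3 ≠ 0` ⟹ `ω ≠ 1`. [folklore] -/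
theorem ne_one_of_cubic (hω : ω ^ 2 + ω + 1 = 0) (h3 : (3 : L) ≠ 0) : ω ≠ 1 := by
  rintro rfl; apply h3; linear_combination hω

/-- `ω² + ω + 1 = 0`, `3 ≠ 0` ⟹ `ω² ≠ 1`. [folklore] -/
theorem sq_ne_one_of_cubic (hω : ω ^ 2 + ω + 1 = 0) (h3 : (3 : L) ≠ 0) : ω ^ 2 ≠ 1 := by
  intro h
  have hω' : ω = -2 := by linear_combination hω - h
  apply h3
  have : (-2 : L) ^ 2 = 1 := by rw [← hω']; exact h
  linear_combination this

/-- Reduction of exponents: `ω ^ n = ω ^ (n % 3)`. [folklore] -/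
theorem pow_eq_pow_mod_three (hω : ω ^ 2 + ω + 1 = 0) (n : ℕ) : ω ^ n = ω ^ (n % 3) := by
  conv_lhs => rw [← Nat.div_add_mod n 3, pow_add, pow_mul, SylvesterTwoCMNormForm.omega_pow_three hω, one_pow, one_mul]

/-- `ω ^ n = 1` iff `3 ∣ n` (for a primitive cube root of unity `ω`, `char ≠ 3`). [folklore] -/
theorem pow_eq_one_iff_three_dvd (hω : ω ^ 2 + ω + 1 = 0) (h3 : (3 : L) ≠ 0) (n : ℕ) : ω ^ n = 1 ↔ 3 ∣ n := by
  rw [pow_eq_pow_mod_three hω n, Nat.dvd_iff_mod_eq_zero]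
  have hlt : n % 3 < 3 := Nat.mod_lt n (by norm_num)
  constructor
  · intro h
    interval_cases hm : n % 3
    · rfl
    · rw [pow_one] at h; exact absurd h (ne_one_of_cubic hω h3)
    · exact absurd h (sq_ne_one_of_cubic hω h3)
  · intro h; rw [h, pow_zero]

/-- Injectivity of exponents mod `3`: `ω ^ a = ω ^ b ⟹ a ≡ b (mod 3)`. [folklore] -/
theorem mod_eq_of_pow_eq_pow (hω : ω ^ 2 + ω + 1 = 0) (h3 : (3 : L) ≠ 0) {a b : ℕ} (h : ω ^ a = ω ^ b) :
    a % 3 = b % 3 := by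
  have hω0 : ω ≠ 0 := by rintro rfl; norm_num at hω
  wlog hab : b ≤ a generalizing a b
  · exact (this h.symm (not_le.mp hab).le).symm
  obtain ⟨d, rfl⟩ := Nat.exists_eq_add_of_le hab
  have hd : ω ^ d = 1 := by
    rw [pow_add] at h
    exact mul_left_cancel₀ (pow_ne_zero b hω0) (h.trans (mul_one _).symm)
  have hd3 : d % 3 = 0 := Nat.dvd_iff_mod_eq_zero.mp ((pow_eq_one_iff_three_dvd hω h3 d).mp hd)
  omega

/-- The roots of `t² + t + 1` are `ω` and `ω²`. [folklore] -/
theorem eq_or_eq_sq_of_cubic (hω : ω ^ 2 + ω + 1 = 0) {t : L} (ht : t ^ 2 + t + 1 = 0) : t = ω ∨ t = ω ^ 2 := by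
  have h : (t - ω) * (t - ω ^ 2) = 0 := by
    have e : (t - ω) * (t - ω ^ 2) = (t ^ 2 + t + 1) - (ω ^ 2 + ω + 1) * t + (ω ^ 3 - 1) := by ring
    rw [e, ht, hω, SylvesterTwoCMNormForm.omega_pow_three hω]; ring
  rcases mul_eq_zero.mp h with h | h
  · exact Or.inl (sub_eq_zero.mp h)
  · exact Or.inr (sub_eq_zero.mp h)

/-- The cube roots of `α³ ≠ 0` are `ω^j α`, `j < 3`. [folklore] -/
theorem exists_eq_pow_mul_of_pow_three_eq (hω : ω ^ 2 + ω + 1 = 0) {α β : L} (hα : α ≠ 0) (h : β ^ 3 = α ^ 3) :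
    ∃ j : ℕ, j < 3 ∧ β = ω ^ j * α := by
  set t := β * α⁻¹ with ht
  have hβ : β = t * α := by rw [ht, inv_mul_cancel_right₀ hα]
  have ht3 : t ^ 3 = 1 := by
    rw [ht, mul_pow, h, inv_pow, mul_inv_cancel₀ (pow_ne_zero 3 hα)]
  have hfac : (t - 1) * (t ^ 2 + t + 1) = 0 := by
    have : (t - 1) * (t ^ 2 + t + 1) = t ^ 3 - 1 := by ring
    rw [this, ht3, sub_self]
  rcases mul_eq_zero.mp hfac with h1 | h2
  · exact ⟨0, by norm_num, by rw [pow_zero, one_mul, hβ, sub_eq_zero.mp h1, one_mul]⟩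
  · rcases eq_or_eq_sq_of_cubic hω h2 with h | h
    · exact ⟨1, by norm_num, by rw [pow_one, hβ, h]⟩
    · exact ⟨2, by norm_num, by rw [hβ, h]⟩

end CubeRoots

/-! ### §2 The Kummer exclusion -/

section Exclusion

variable {Γ : Type*} [Group Γ] {L : Type*} [Field L] [MulSemiringAction Γ L]

/-- A ring-action element maps a primitive cube root of unity to `ω` or `ω²`. [folklore] -/
theorem smul_eq_or_eq_sq {ω : L} (hω : ω ^ 2 + ω + 1 = 0) (g : Γ) : g • ω = ω ∨ g • ω = ω ^ 2 := by
  apply eq_or_eq_sq_of_cubic hω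
  have h := congrArg (fun t : L ↦ g • t) hω
  simpa only [smul_add, smul_pow', smul_one, smul_zero] using h

/-- An element fixing `x = α³ ≠ 0` maps `α` to `ω^j α` for some `j < 3`. [folklore] -/
theorem exists_smul_eq_pow_mul {ω : L} (hω : ω ^ 2 + ω + 1 = 0) {α : L} (hα : α ≠ 0) {g : Γ}
    (hg : g • (α ^ 3) = α ^ 3) : ∃ j : ℕ, j < 3 ∧ g • α = ω ^ j * α :=
  exists_eq_pow_mul_of_pow_three_eq hω hα (by rw [← smul_pow', hg])

/-- **The Kummer exclusion (cubic case).** `Γ` acts on a field `L` with `3 ≠ 0`; `H ≤ Γ` fixes `x`, and NO `H`-fixed element of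
`L` is a cube root of `x`; `P₀ ≤ H` is normalised by `H`, contains every commutator of `H`, and fixes the primitive cube root of unity
`ω`, which some element of `H` moves; `ρ : Γ →* M` has, for every `p ∈ P₀`, some `k` prime to `3` with `ρ(p^k) = 1`. Then for every
cube root `α` of `x` there is `n ∈ P₀` with `ρ n = 1` and `n • α ≠ α`. Proof in the module docstring.
[cite: GrossLMS1991, §9 (Kummer independence in the choice of Frobenius)] [cite: Cox2013, §5.B, §8.B] -/
theorem exists_mem_map_eq_one_smul_ne (h3 : (3 : L) ≠ 0) {H P₀ : Subgroup Γ} (hP₀H : P₀ ≤ H)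
    (hcomm : ∀ a ∈ H, ∀ b ∈ H, a * b * a⁻¹ * b⁻¹ ∈ P₀)
    {M : Type*} [Monoid M] (ρ : Γ →* M) (hρ : ∀ p ∈ P₀, ∃ k : ℕ, ¬ 3 ∣ k ∧ ρ (p ^ k) = 1)
    {ω : L} (hω : ω ^ 2 + ω + 1 = 0) (hP₀ω : ∀ p ∈ P₀, p • ω = ω) (hHω : ∃ c ∈ H, c • ω ≠ ω)
    {x : L} (hHx : ∀ h ∈ H, h • x = x) (hfix : ∀ y : L, (∀ h ∈ H, h • y = y) → y ^ 3 ≠ x)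
    {α : L} (hα : α ^ 3 = x) :
    ∃ n ∈ P₀, ρ n = 1 ∧ n • α ≠ α := by
  have hω3 : ω ^ 3 = 1 := SylvesterTwoCMNormForm.omega_pow_three hω
  -- `α ≠ 0` (else `0` is an `H`-fixed cube root of `x = 0`)
  have hα0 : α ≠ 0 := by
    rintro rfl
    exact hfix 0 (fun h _ ↦ smul_zero h) (by rw [← hα])
  -- every `h ∈ H` fixes `α³`
  have hHα3 : ∀ h ∈ H, h • (α ^ 3) = α ^ 3 := fun h hh ↦ by rw [hα]; exact hHx h hh
  -- action on the roots `ω^j α` of an element fixing `ω`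
  have hrot : ∀ g : Γ, g • ω = ω → ∀ (i j : ℕ), g • α = ω ^ i * α → g • (ω ^ j * α) = ω ^ (j + i) * α := by
    intro g hgω i j hgα
    rw [smul_mul', smul_pow', hgω, hgα, pow_add, mul_assoc]
  by_contra hcon
  push Not at hcon
  -- (i) every `p ∈ P₀` fixes `α`
  have hP₀α : ∀ p ∈ P₀, p • α = α := by
    intro p hp
    obtain ⟨j, hj, hpα⟩ := exists_smul_eq_pow_mul hω hα0 (hHα3 p (hP₀H hp))
    -- `p^k • α = ω^{jk} α`
    have hpow : ∀ k : ℕ, (p ^ k) • α = ω ^ (j * k) * α := by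
      intro k
      induction k with
      | zero => rw [pow_zero, one_smul, mul_zero, pow_zero, one_mul]
      | succ k ih =>
        rw [pow_succ', mul_smul, ih, hrot p (hP₀ω p hp) j (j * k) hpα, Nat.mul_succ]
    obtain ⟨k, hk3, hρk⟩ := hρ p hp
    have hfixk : (p ^ k) • α = α := hcon (p ^ k) (P₀.pow_mem hp k) hρk
    rw [hpow k] at hfixk
    have h1 : ω ^ (j * k) = 1 := mul_right_cancel₀ hα0 (hfixk.trans (one_mul α).symm)
    rw [pow_eq_one_iff_three_dvd hω h3] at h1
    rcases (Nat.Prime.dvd_mul Nat.prime_three).mp h1 with hj3 | hk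
    · interval_cases j
      · rw [pow_zero, one_mul] at hpα; exact hpα
      · exact absurd hj3 (by norm_num)
      · exact absurd hj3 (by norm_num)
    · exact absurd hk hk3
  -- `P₀` fixes every root
  have hP₀root : ∀ p ∈ P₀, ∀ j : ℕ, p • (ω ^ j * α) = ω ^ j * α := by
    intro p hp j
    rw [hrot p (hP₀ω p hp) 0 j (by rw [pow_zero, one_mul]; exact hP₀α p hp), add_zero]
  -- (ii) an element `c ∈ H` with `c ω = ω²`; write `c α = ω^m α`
  obtain ⟨c, hcH, hcω⟩ := hHω
  have hcω2 : c • ω = ω ^ 2 := (smul_eq_or_eq_sq hω c).resolve_left hcω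
  have hcinvω : c⁻¹ • ω = ω ^ 2 := by
    have h : c • (ω ^ 2) = ω := by
      rw [smul_pow', hcω2, ← pow_mul, pow_eq_pow_mod_three hω (2 * 2)]; norm_num
    have := congrArg (fun t : L ↦ c⁻¹ • t) h
    simp only [inv_smul_smul] at this
    exact this.symm
  obtain ⟨m, hm, hcα⟩ := exists_smul_eq_pow_mul hω hα0 (hHα3 c hcH)
  -- `c (ω^j α) = ω^{2j+m} α`
  have hcroot : ∀ j : ℕ, c • (ω ^ j * α) = ω ^ (2 * j + m) * α := by
    intro j
    rw [smul_mul', smul_pow', hcω2, hcα, ← pow_mul, pow_add, mul_assoc, mul_comm 2 j]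
  by_cases hcase : ∃ h ∈ H, h • ω = ω ∧ h • α ≠ α
  · -- case (b): `h` fixes `ω`, moves `α`: compare `h c α` and `c h α`
    obtain ⟨h, hhH, hhω, hhα⟩ := hcase
    obtain ⟨i, hi, hiα⟩ := exists_smul_eq_pow_mul hω hα0 (hHα3 h hhH)
    have hi0 : i ≠ 0 := by rintro rfl; rw [pow_zero, one_mul] at hiα; exact hhα hiα
    -- the commutator `q = h c h⁻¹ c⁻¹ ∈ P₀` fixes every root, so `(h c) α = (c h) α`
    have hq : h * c * h⁻¹ * c⁻¹ ∈ P₀ := hcomm h hhH c hcH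
    have hch : (c * h) • α = ω ^ (2 * i + m) * α := by rw [mul_smul, hiα, hcroot i]
    have heq : (h * c) • α = (c * h) • α := by
      have e : h * c = (h * c * h⁻¹ * c⁻¹) * (c * h) := by group
      rw [e, mul_smul (h * c * h⁻¹ * c⁻¹) (c * h) α, hch, hP₀root _ hq]
    rw [mul_smul, hcα, hrot h hhω i m hiα, hch] at heq
    have hexp := mod_eq_of_pow_eq_pow hω h3 (mul_right_cancel₀ hα0 heq)
    interval_cases i <;> omega
  · -- case (a): every `h ∈ H` fixing `ω` fixes `α`; then `ω^{2m} α` is `H`-fixed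
    push Not at hcase
    apply hfix (ω ^ (2 * m) * α) ?_ (by rw [mul_pow, ← pow_mul, hα, pow_eq_pow_mod_three hω,
      show 2 * m * 3 % 3 = 0 by omega, pow_zero, one_mul])
    intro g hgH
    rcases smul_eq_or_eq_sq hω g with hgω | hgω
    · -- `g` fixes `ω`, hence `α`, hence every root
      rw [hrot g hgω 0 (2 * m) (by rw [pow_zero, one_mul]; exact hcase g hgH hgω), add_zero]
    · -- `g = c g'` with `g'` fixing `ω`
      set g' := c⁻¹ * g with hg'
      have hg'H : g' ∈ H := H.mul_mem (H.inv_mem hcH) hgH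
      have hg'ω : g' • ω = ω := by
        rw [hg', mul_smul, hgω, smul_pow', hcinvω, ← pow_mul, pow_eq_pow_mod_three hω (2 * 2)]; norm_num
      have hg'α : g' • α = α := hcase g' hg'H hg'ω
      have e : g = c * g' := by rw [hg', mul_inv_cancel_left]
      rw [e, mul_smul, hrot g' hg'ω 0 (2 * m) (by rw [pow_zero, one_mul]; exact hg'α), add_zero, hcroot (2 * m),
        pow_eq_pow_mod_three hω (2 * (2 * m) + m), pow_eq_pow_mod_three hω (2 * m)]
      congr 2
      omega

end Exclusion

end Summit.BirchSwinnertonDyer.BirchSwinnertonDyer.Theorems.ChebKummerThree
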